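import Literature.Computability.Complexity.ZIntBricks
import Literature.Computability.Complexity.PlumbingBricks
import Literature.Computability.Complexity.StackBricksArith

/-!
# Crux `ArithStatLadder.IqThreeNotPPoly` (stmt-QuantumAdvantage-2422)

Stub `stub_samplerNagellFP` of the line `Sketch` (skeleton v4, NAGELL PLANTING): the sampler of the
planted family is a polynomial-time string function.

On an input pair `⟨x, r⟩` (numeral `x`, `N = ⟦x⟧ = bitsToNat x`, and seed `r`, `j = ⟦r⟧`) it
outputs the canonical numeral of `d = G t · (G t + 8) · (4 G t + 27)` with `G = N / gcd(N, 6)` and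
`t = 1 + 11 G + 11 G² + 30 G j` — a `+, ×` polynomial in `(G, j)` over `ℕ` (no subtraction).

The witness is an explicit composition of the tree's `FP` bricks (no machine is written):
* `G` is the value of the numeral brick `divFn ∘ ⟨fstF, gcdFn ∘ ⟨fstF, bin 6⟩⟩` (`exists_gF`;
  `divFn_boolPair`, `gcdFn_boolPair`), and `j` the value of `sndF`; both are lifted to the
  difference-pair integer code of `ZIntBricks.lean` (`exists_ival_nat`);
* the integer `G t (G t + 8) (4 G t + 27)` by `zmulF`, `zaddF`, `zcanonF` (values tracked through
  `Brick.ival`; `exists_arithNagell`);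
* the absolute value as `addFn` of the two canonical components (`bitsToNat_cP_add_cQ`), and the
  integer closed form is the cast of the natural one (`natAbs_closedForm`, `push_cast; ring`).
Membership in `FP` is by the closure lemmas `comp_mem_FP`, `fanoutFn_mem_FP`, `const_mem_FP`; the
closed form holds on every input (all functions are total).
-/

noncomputable section

set_option linter.dupNamespace false -- D-0017: single-problem summit ⇒ `QuantumAdvantage.QuantumAdvantage` by design

namespace Summit.QuantumAdvantage.QuantumAdvantage.Theorems.IqThreeNotPPoly

open scoped Classical
open _root_.Computability Literature.Computability.Complexity
open Literature.Computability.Complexity.Brick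

/-! ### Integer-valued `FP` expressions (values tracked through `Brick.ival`)

Copied from `ArithStatLadderIqThreeNotPPolyStubSamplerAP.lean` (the helpers are `private` there). -/

/-- A numeral-valued brick `p ∈ FP` lifts to an integer code of value `⟦p z⟧` (pair it with `ε`).
(copied from ArithStatLadderIqThreeNotPPolyStubSamplerAP.lean) -/
private theorem exists_ival_nat {p : List Bool → List Bool} (hp : p ∈ FP) :
    ∃ m ∈ FP, ∀ z, ival (m z) = (bitsToNat (p z) : ℤ) :=
  ⟨fanoutFn p (fun _ => []), fanoutFn_mem_FP hp (const_mem_FP _), fun z => by simp⟩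

/-- Integer constants are `FP` expressions.
(copied from ArithStatLadderIqThreeNotPPolyStubSamplerAP.lean) -/
private theorem exists_ival_const (c : ℤ) : ∃ m ∈ FP, ∀ z, ival (m z) = c :=
  ⟨fun _ => dpEnc c, const_mem_FP _, fun _ => ival_dpEnc c⟩

/-- Products of `FP` expressions (`zmulF`).
(copied from ArithStatLadderIqThreeNotPPolyStubSamplerAP.lean) -/
private theorem exists_ival_mul {φ ψ : List Bool → ℤ}
    (hφ : ∃ m ∈ FP, ∀ z, ival (m z) = φ z) (hψ : ∃ m ∈ FP, ∀ z, ival (m z) = ψ z) :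
    ∃ m ∈ FP, ∀ z, ival (m z) = φ z * ψ z := by
  obtain ⟨p, hp, hpv⟩ := hφ
  obtain ⟨q, hq, hqv⟩ := hψ
  exact ⟨zmulF ∘ fanoutFn p q, comp_mem_FP zmulF_mem_FP (fanoutFn_mem_FP hp hq), fun z => by
    rw [Function.comp_apply, fanoutFn_apply, zmulF_boolPair, ival_dpEnc, hpv, hqv]⟩

/-- Sums of `FP` expressions (`zaddF`).
(copied from ArithStatLadderIqThreeNotPPolyStubSamplerAP.lean) -/
private theorem exists_ival_add {φ ψ : List Bool → ℤ}
    (hφ : ∃ m ∈ FP, ∀ z, ival (m z) = φ z) (hψ : ∃ m ∈ FP, ∀ z, ival (m z) = ψ z) :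
    ∃ m ∈ FP, ∀ z, ival (m z) = φ z + ψ z := by
  obtain ⟨p, hp, hpv⟩ := hφ
  obtain ⟨q, hq, hqv⟩ := hψ
  exact ⟨zaddF ∘ fanoutFn p q, comp_mem_FP zaddF_mem_FP (fanoutFn_mem_FP hp hq), fun z => by
    rw [Function.comp_apply, fanoutFn_apply, zaddF_boolPair, ival_dpEnc, hpv, hqv]⟩

/-- Canonical output of an `FP` expression (`zcanonF`): the code `dpEnc` of its value.
(copied from ArithStatLadderIqThreeNotPPolyStubSamplerAP.lean) -/
private theorem exists_canon {φ : List Bool → ℤ} (hφ : ∃ m ∈ FP, ∀ z, ival (m z) = φ z) :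
    ∃ m ∈ FP, ∀ z, m z = dpEnc (φ z) := by
  obtain ⟨p, hp, hpv⟩ := hφ
  exact ⟨zcanonF ∘ p, comp_mem_FP zcanonF_mem_FP hp, fun z => by
    rw [Function.comp_apply, zcanonF_eq, hpv]⟩

/-- The absolute value of a canonical code as a numeral: `addFn (dpEnc z) = bin |z|`.
(copied from ArithStatLadderIqThreeNotPPolyStubSamplerAP.lean) -/
private theorem addFn_dpEnc (z : ℤ) : addFn (dpEnc z) = encodeNat z.natAbs := by
  rw [dpEnc_eq, addFn_boolPair, bitsToNat_cP_add_cQ]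

/-! ### The new ingredient: the numeral `G = N / gcd(N, 6)` -/

/-- The numeral brick of `G = N / gcd(N, 6)` on `⟨x, r⟩`, `N = ⟦x⟧`: the quotient of the first
component by its gcd with the constant `6`, `divFn ∘ ⟨fstF, gcdFn ∘ ⟨fstF, bin 6⟩⟩ ∈ FP`
(`divFn_boolPair`, `gcdFn_boolPair`; closure under `∘` and fan-out). -/
private theorem exists_gF : ∃ g ∈ FP, ∀ x r : List Bool,
    bitsToNat (g (boolPair x r)) = bitsToNat x / Nat.gcd (bitsToNat x) 6 := by
  refine ⟨divFn ∘ fanoutFn fstF (gcdFn ∘ fanoutFn fstF (fun _ => encodeNat 6)),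
    comp_mem_FP divFn_mem_FP (fanoutFn_mem_FP fstF_mem_FP
      (comp_mem_FP gcdFn_mem_FP (fanoutFn_mem_FP fstF_mem_FP (const_mem_FP _)))), fun x r => ?_⟩
  simp only [Function.comp_apply, fanoutFn_apply, fstF_boolPair, gcdFn_boolPair,
    bitsToNat_encodeNat, divFn_boolPair]

/-! ### The arithmetic stage: the integer closed form on `⟨x, r⟩` -/

/-- On pairs `⟨x, r⟩` an `FP` function outputs the canonical code of the integer
`G t (G t + 8) (4 G t + 27)`, `G = ⟦x⟧ / gcd(⟦x⟧, 6)`, `t = 1 + 11 G + 11 G G + 30 G ⟦r⟧`. -/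
private theorem exists_arithNagell : ∃ h ∈ FP, ∀ x r : List Bool,
    h (boolPair x r) = dpEnc
      ((((bitsToNat x / Nat.gcd (bitsToNat x) 6 : ℕ) : ℤ) *
        (1 + 11 * ((bitsToNat x / Nat.gcd (bitsToNat x) 6 : ℕ) : ℤ) +
          11 * ((bitsToNat x / Nat.gcd (bitsToNat x) 6 : ℕ) : ℤ) *
            ((bitsToNat x / Nat.gcd (bitsToNat x) 6 : ℕ) : ℤ) +
          30 * ((bitsToNat x / Nat.gcd (bitsToNat x) 6 : ℕ) : ℤ) * bitsToNat r)) *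
      ((((bitsToNat x / Nat.gcd (bitsToNat x) 6 : ℕ) : ℤ) *
        (1 + 11 * ((bitsToNat x / Nat.gcd (bitsToNat x) 6 : ℕ) : ℤ) +
          11 * ((bitsToNat x / Nat.gcd (bitsToNat x) 6 : ℕ) : ℤ) *
            ((bitsToNat x / Nat.gcd (bitsToNat x) 6 : ℕ) : ℤ) +
          30 * ((bitsToNat x / Nat.gcd (bitsToNat x) 6 : ℕ) : ℤ) * bitsToNat r)) + 8) *
      (4 * (((bitsToNat x / Nat.gcd (bitsToNat x) 6 : ℕ) : ℤ) *
        (1 + 11 * ((bitsToNat x / Nat.gcd (bitsToNat x) 6 : ℕ) : ℤ) +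
          11 * ((bitsToNat x / Nat.gcd (bitsToNat x) 6 : ℕ) : ℤ) *
            ((bitsToNat x / Nat.gcd (bitsToNat x) 6 : ℕ) : ℤ) +
          30 * ((bitsToNat x / Nat.gcd (bitsToNat x) 6 : ℕ) : ℤ) * bitsToNat r)) + 27)) := by
  obtain ⟨g, hg, hgv⟩ := exists_gF
  have hG : ∃ m ∈ FP, ∀ z, ival (m z) = (bitsToNat (g z) : ℤ) := exists_ival_nat hg
  have hJ : ∃ m ∈ FP, ∀ z, ival (m z) = (bitsToNat (sndF z) : ℤ) := exists_ival_nat sndF_mem_FP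
  -- `t = 1 + 11 G + 11 G G + 30 G j`
  have hT := exists_ival_add (exists_ival_add (exists_ival_add (exists_ival_const 1)
    (exists_ival_mul (exists_ival_const 11) hG))
    (exists_ival_mul (exists_ival_mul (exists_ival_const 11) hG) hG))
    (exists_ival_mul (exists_ival_mul (exists_ival_const 30) hG) hJ)
  -- `u = G t`
  have hU := exists_ival_mul hG hT
  -- `u (u + 8) (4 u + 27)`
  have hD := exists_ival_mul (exists_ival_mul hU (exists_ival_add hU (exists_ival_const 8)))
    (exists_ival_add (exists_ival_mul (exists_ival_const 4) hU) (exists_ival_const 27))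
  obtain ⟨h, hh, hhv⟩ := exists_canon hD
  refine ⟨h, hh, fun x r => ?_⟩
  rw [hhv, hgv, sndF_boolPair]

/-- The integer closed form is the cast of the natural one (a `+, ×` polynomial in `(G, j)`), so
its absolute value is the natural closed form. -/
private theorem natAbs_closedForm (G j : ℕ) :
    Int.natAbs ((G : ℤ) * (1 + 11 * (G : ℤ) + 11 * (G : ℤ) * (G : ℤ) + 30 * (G : ℤ) * j) *
      ((G : ℤ) * (1 + 11 * (G : ℤ) + 11 * (G : ℤ) * (G : ℤ) + 30 * (G : ℤ) * j) + 8) *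
      (4 * ((G : ℤ) * (1 + 11 * (G : ℤ) + 11 * (G : ℤ) * (G : ℤ) + 30 * (G : ℤ) * j)) + 27)) =
    G * (1 + 11 * G + 11 * G ^ 2 + 30 * G * j) *
      (G * (1 + 11 * G + 11 * G ^ 2 + 30 * G * j) + 8) *
      (4 * (G * (1 + 11 * G + 11 * G ^ 2 + 30 * G * j)) + 27) := by
  have e : (G : ℤ) * (1 + 11 * (G : ℤ) + 11 * (G : ℤ) * (G : ℤ) + 30 * (G : ℤ) * j) *
      ((G : ℤ) * (1 + 11 * (G : ℤ) + 11 * (G : ℤ) * (G : ℤ) + 30 * (G : ℤ) * j) + 8) *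
      (4 * ((G : ℤ) * (1 + 11 * (G : ℤ) + 11 * (G : ℤ) * (G : ℤ) + 30 * (G : ℤ) * j)) + 27) =
      ((G * (1 + 11 * G + 11 * G ^ 2 + 30 * G * j) *
        (G * (1 + 11 * G + 11 * G ^ 2 + 30 * G * j) + 8) *
        (4 * (G * (1 + 11 * G + 11 * G ^ 2 + 30 * G * j)) + 27) : ℕ) : ℤ) := by
    push_cast; ring
  rw [e, Int.natAbs_natCast]

/-! ### The registered stub -/

/-- **STUB · `stub_samplerNagellFP`.** The sampler of the Nagell planted family — on `⟨x, r⟩`, with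
`N = ⟦x⟧`, `j = ⟦r⟧`, `G = N / gcd(N, 6)`, `t = 1 + 11 G + 11 G² + 30 G j`, output the canonical
numeral of `G t (G t + 8) (4 G t + 27)` — is a polynomial-time string function:
`addFn ∘ arith` with the integer stage `exists_arithNagell`, the absolute value `addFn_dpEnc`, and
the comparison of closed forms `natAbs_closedForm`. -/
theorem stub_samplerNagellFP :
    ∃ f : List Bool → List Bool, f ∈ FP ∧ ∀ x r : List Bool,
    f (boolPair x r) = encodeNat
      ((bitsToNat x / Nat.gcd (bitsToNat x) 6) *
        (1 + 11 * (bitsToNat x / Nat.gcd (bitsToNat x) 6) +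
          11 * (bitsToNat x / Nat.gcd (bitsToNat x) 6) ^ 2 +
          30 * (bitsToNat x / Nat.gcd (bitsToNat x) 6) * bitsToNat r) *
        ((bitsToNat x / Nat.gcd (bitsToNat x) 6) *
          (1 + 11 * (bitsToNat x / Nat.gcd (bitsToNat x) 6) +
            11 * (bitsToNat x / Nat.gcd (bitsToNat x) 6) ^ 2 +
            30 * (bitsToNat x / Nat.gcd (bitsToNat x) 6) * bitsToNat r) + 8) *
        (4 * ((bitsToNat x / Nat.gcd (bitsToNat x) 6) *
          (1 + 11 * (bitsToNat x / Nat.gcd (bitsToNat x) 6) +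
            11 * (bitsToNat x / Nat.gcd (bitsToNat x) 6) ^ 2 +
            30 * (bitsToNat x / Nat.gcd (bitsToNat x) 6) * bitsToNat r)) + 27)) := by
  obtain ⟨h, hh, hhv⟩ := exists_arithNagell
  refine ⟨addFn ∘ h, comp_mem_FP addFn_mem_FP hh, fun x r => ?_⟩
  rw [Function.comp_apply, hhv, addFn_dpEnc, natAbs_closedForm]

end Summit.QuantumAdvantage.QuantumAdvantage.Theorems.IqThreeNotPPoly

end
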